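import Summits.AnomalousDissipation.AnomalousDissipation.Theorems.SolenoidalFractalHomogenisationLagrangianStepVmodFrameDefsJ
import Summits.AnomalousDissipation.AnomalousDissipation.Theorems.SolenoidalFractalHomogenisationLagrangianStepFrameTestPiola
import Summits.AnomalousDissipation.AnomalousDissipation.Theorems.SolenoidalFractalHomogenisationLagrangianStepCellClauseModConst
import Literature.Analysis.FunctionSpaces.TorusClassicalNSUniqueness
import HarnessLib

/-!
# K1L_D (stmt-AnomalousDissipation-27980), memo L24 §1/§6 (b1): three binder-free bricks of the long-row architecture
# (helper, `--supports 27980 --as helper`; prover lead-k1l-onelevel-p1 g7)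

* §1 **(O2) Piola kills every zero-order coupling**: for a matrix field `M` with divergence-free columns,
  `∇·(M v) = Σ_{a,c} M_{ca} ∂_c v_a` (`CellClauseMod.divergence_distort_of_piola`); hence the divergence of `(G t₂ − G t₁)·v` carries `∇v`
  (`divergence_distort_sub_of_piola`) — the constraint drift / pressure source of the distorted dynamics never has a zero-order part.
* §2 **Monotonicity** of the class of record and of the local regularity predicate in `(θ, nC)` (`IsModulation.mono`, `IsFrameModulation.mono`,
  `VmodDist.IsFrameRegular.mono`) — used by the FJ head to take the max of the constants of the modulation instance and of the regularity instance.
* §3 **(O1) at propagator level**: for a v2 distorted propagator over a frame modulation, constants are fixed: `⟪U s t x, c⟫ = ⟪x, c⟫` for `G(s)`-solenoidal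
  `x` and a.e. `t` (`IsDistortedPropagatorS.ae_inner_apply_const_eq`, from `exists_sol` + `repr` + mean conservation p719406).
No sorry, no definition, no named fact.  NOT a proof of any block, of `stub_Vmod_EHTthg`, of K1L_D or AD; rung F-D1.A0.
-/

set_option linter.dupNamespace false

noncomputable section

namespace Summit.AnomalousDissipation.AnomalousDissipation.Theorems.SolenoidalFractalHomogenisation.LagrangianStep.CellClauseMod

open Literature.Analysis Literature.Analysis.FluidPDE Literature.Analysis.FunctionSpaces Literature.Analysis.FunctionSpaces.Torus
open MeasureTheory Set Filter
open scoped ENNReal NNReal InnerProductSpace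

/-! ## §1 (O2) — divergence of a distorted field under Piola columns -/

section Piola

variable {d : Type*} [Fintype d] [DecidableEq d]

/-- **Piola product rule.**  If the columns of `M` are smooth and divergence free (`Σ_c ∂_c M_{ca} = 0` for every `a`) and `v` is smooth, then
`∇·(M v)(y) = Σ_a Σ_c M(y)_{ca} · ∂_c v_a (y)` — no zero-order term. (Evans, PDE §8.1.4.b.) [folklore] -/
theorem divergence_distort_of_piola {M : UnitAddTorus d → Matrix d d ℝ} (hM : ∀ c a, IsSmooth (fun y => M y c a))
    (hPiola : ∀ (a : d) (y : UnitAddTorus d), ∑ c, partialDeriv c (fun y' => M y' c a) y = 0)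
    {v : UnitAddTorus d → EuclideanSpace ℝ d} (hv : IsSmooth v) (y : UnitAddTorus d) :
    Torus.divergence (FluidPDE.Torus.distort M v) y = ∑ a, ∑ c, M y c a * partialDeriv c (fun y' => v y' a) y := by
  have hva : ∀ a, IsSmooth (fun x => v x a) := fun a => hv.apply a
  have hprod : ∀ c a, IsSmooth (fun y' => M y' c a * v y' a) := fun c a => ContDiff.mul (hM c a) (hva a)
  unfold Torus.divergence
  have e1 : ∀ c, (fun y' => FluidPDE.Torus.distort M v y' c) = fun y' => ∑ a, M y' c a * v y' a := fun c => by
    funext y'; rw [FluidPDE.Torus.distort_apply]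
  simp_rw [e1]
  calc ∑ c, partialDeriv c (fun y' => ∑ a, M y' c a * v y' a) y
      = ∑ c, ∑ a, partialDeriv c (fun y' => M y' c a * v y' a) y :=
        Finset.sum_congr rfl fun c _ => partialDeriv_finset_sum _ (fun a _ => (hprod c a).isContDiff (by simp)) c y
    _ = ∑ c, ∑ a, (M y c a * partialDeriv c (fun y' => v y' a) y + partialDeriv c (fun y' => M y' c a) y * v y a) :=
        Finset.sum_congr rfl fun c _ => Finset.sum_congr rfl fun a _ =>
          partialDeriv_mul ((hM c a).isContDiff (by simp)) ((hva a).isContDiff (by simp)) c y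
    _ = ∑ a, ∑ c, (M y c a * partialDeriv c (fun y' => v y' a) y + partialDeriv c (fun y' => M y' c a) y * v y a) := Finset.sum_comm
    _ = ∑ a, (∑ c, M y c a * partialDeriv c (fun y' => v y' a) y + (∑ c, partialDeriv c (fun y' => M y' c a) y) * v y a) :=
        Finset.sum_congr rfl fun a _ => by rw [Finset.sum_add_distrib, Finset.sum_mul]
    _ = ∑ a, ∑ c, M y c a * partialDeriv c (fun y' => v y' a) y :=
        Finset.sum_congr rfl fun a _ => by rw [hPiola a y, zero_mul, add_zero]

/-- The Piola hypothesis from divergence-free columns stated with `Torus.IsDivFree`. -/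
theorem sum_partialDeriv_col_eq_zero_of_isDivFree {M : UnitAddTorus d → Matrix d d ℝ}
    (hcol : ∀ a, Torus.IsDivFree (fun y => (WithLp.toLp 2 fun c => M y c a : EuclideanSpace ℝ d))) (a : d) (y : UnitAddTorus d) :
    ∑ c, partialDeriv c (fun y' => M y' c a) y = 0 := by
  have h := hcol a y
  unfold Torus.divergence at h
  exact h

/-- **Differences of Piola frames are Piola**: `∇·((M₂ − M₁) v) = Σ (M₂ − M₁)_{ca} ∂_c v_a` — in particular the constraint drift between two times of a
modulation datum carries `∇v` (memo L24 (O2)). -/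
theorem divergence_distort_sub_of_piola {M₁ M₂ : UnitAddTorus d → Matrix d d ℝ}
    (hM₁ : ∀ c a, IsSmooth (fun y => M₁ y c a)) (hM₂ : ∀ c a, IsSmooth (fun y => M₂ y c a))
    (hP₁ : ∀ (a : d) (y : UnitAddTorus d), ∑ c, partialDeriv c (fun y' => M₁ y' c a) y = 0)
    (hP₂ : ∀ (a : d) (y : UnitAddTorus d), ∑ c, partialDeriv c (fun y' => M₂ y' c a) y = 0)
    {v : UnitAddTorus d → EuclideanSpace ℝ d} (hv : IsSmooth v) (y : UnitAddTorus d) :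
    Torus.divergence (FluidPDE.Torus.distort (fun y => M₂ y - M₁ y) v) y = ∑ a, ∑ c, (M₂ y c a - M₁ y c a) * partialDeriv c (fun y' => v y' a) y := by
  have hM : ∀ c a, IsSmooth (fun y => (M₂ y - M₁ y) c a) := fun c a => by
    simp only [Matrix.sub_apply]; exact (hM₂ c a).sub (hM₁ c a)
  have hP : ∀ (a : d) (y : UnitAddTorus d), ∑ c, partialDeriv c (fun y' => (M₂ y' - M₁ y') c a) y = 0 := by
    intro a y
    simp only [Matrix.sub_apply]
    have e : ∀ c, partialDeriv c (fun y' => M₂ y' c a - M₁ y' c a) y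
        = partialDeriv c (fun y' => M₂ y' c a) y - partialDeriv c (fun y' => M₁ y' c a) y := fun c => by
      have h := congrFun (partialDeriv_sub (f := fun y' => M₂ y' c a) (g := fun y' => M₁ y' c a)
        ((hM₂ c a).isContDiff (by simp)) ((hM₁ c a).isContDiff (by simp)) c) y
      exact h
    simp_rw [e]
    rw [Finset.sum_sub_distrib, hP₁ a y, hP₂ a y, sub_zero]
  rw [divergence_distort_of_piola hM hP hv y]
  simp only [Matrix.sub_apply]

end Piola

/-! ## §2 Monotonicity in `(θ, nC)` -/

/-- A modulation datum with constants `(θ, nC)` is one with any larger constants (`0 ≤ θ`, `0 ≤ nC'`). -/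
theorem IsModulation.mono {θ θ' Tw nC nC' : ℝ} {G : ℝ → UnitAddTorus (Fin 3) → Matrix (Fin 3) (Fin 3) ℝ} (h : IsModulation θ Tw nC G)
    (hθ : θ ≤ θ') (hnC : nC ≤ nC') (hθ0 : 0 ≤ θ) (hnC'0 : 0 ≤ nC') : IsModulation θ' Tw nC' G where
  init := h.init
  near_one := fun t ht y i j => (h.near_one t ht y i j).trans hθ
  det_one := h.det_one
  piola := h.piola
  smooth := h.smooth
  grad_le := fun t ht y i j c => (h.grad_le t ht y i j c).trans
    ((mul_le_mul_of_nonneg_left hnC hθ0).trans (mul_le_mul_of_nonneg_right hθ hnC'0))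
  lipschitz := h.lipschitz
  tvar := by
    obtain ⟨βr, hβ0, hβi, hβle, hβ⟩ := h.tvar
    exact ⟨βr, hβ0, hβi, hβle.trans hθ, hβ⟩

/-- The class of record is monotone in `(θ, nC)` (`0 ≤ θ`, `0 ≤ nC'`, `0 < Tw` for the rate). -/
theorem IsFrameModulation.mono {θ θ' Tw nC nC' : ℝ} {G : ℝ → UnitAddTorus (Fin 3) → Matrix (Fin 3) (Fin 3) ℝ} (h : IsFrameModulation θ Tw nC G)
    (hθ : θ ≤ θ') (hnC : nC ≤ nC') (hθ0 : 0 ≤ θ) (hnC'0 : 0 ≤ nC') (hTw : 0 < Tw) : IsFrameModulation θ' Tw nC' G where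
  toIsModulation := h.toIsModulation.mono hθ hnC hθ0 hnC'0
  clamped := h.clamped
  rate := fun y i j t₁ ht₁ t₂ ht₂ => (h.rate y i j t₁ ht₁ t₂ ht₂).trans
    (mul_le_mul_of_nonneg_right (div_le_div_of_nonneg_right hθ hTw.le) (abs_nonneg _))
  holonomic := h.holonomic

end Summit.AnomalousDissipation.AnomalousDissipation.Theorems.SolenoidalFractalHomogenisation.LagrangianStep.CellClauseMod

namespace Summit.AnomalousDissipation.AnomalousDissipation.Theorems.SolenoidalFractalHomogenisation.LagrangianStep.VmodDist

open Literature.Analysis Literature.Analysis.FluidPDE Literature.Analysis.FunctionSpaces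
open MeasureTheory Set Filter
open Summit.AnomalousDissipation.AnomalousDissipation.Theorems.SolenoidalFractalHomogenisation.LagrangianStep.CellClauseMod

/-- The local regularity predicate is monotone in `(θ, nC)` (`0 ≤ θ`, `0 ≤ nC`). -/
theorem IsFrameRegular.mono {θ θ' Tw nC nC' : ℝ} {G J : ℝ → UnitAddTorus (Fin 3) → Matrix (Fin 3) (Fin 3) ℝ} (h : IsFrameRegular θ Tw nC G J)
    (hθ : θ ≤ θ') (hnC : nC ≤ nC') (hθ0 : 0 ≤ θ) (hnC0 : 0 ≤ nC) : IsFrameRegular θ' Tw nC' G J where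
  mul_eq_one := h.mul_eq_one
  smooth := h.smooth
  jointCont := h.jointCont
  lipschitz := h.lipschitz
  aeDeriv := h.aeDeriv
  jointContG := h.jointContG
  aeDerivG := h.aeDerivG
  derivBound := fun t ht y i j l hl1 hl2 => by
    obtain ⟨hG, hJ⟩ := h.derivBound t ht y i j l hl1 hl2
    have hpow : nC ^ l.length ≤ nC' ^ l.length := pow_le_pow_left₀ hnC0 hnC _
    have hpow0 : 0 ≤ nC' ^ l.length := pow_nonneg (hnC0.trans hnC) _
    refine ⟨hG.trans ?_, hJ.trans ?_⟩
    · exact (mul_le_mul_of_nonneg_left hpow hθ0).trans (mul_le_mul_of_nonneg_right hθ hpow0)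
    · have h2 : 0 ≤ 2 * θ := by positivity
      exact (mul_le_mul_of_nonneg_left hpow h2).trans (mul_le_mul_of_nonneg_right (by linarith) hpow0)

end Summit.AnomalousDissipation.AnomalousDissipation.Theorems.SolenoidalFractalHomogenisation.LagrangianStep.VmodDist

namespace Summit.AnomalousDissipation.AnomalousDissipation.Theorems.SolenoidalFractalHomogenisation.LagrangianStep.CellClauseMod

open Literature.Analysis Literature.Analysis.FluidPDE Literature.Analysis.FunctionSpaces
open MeasureTheory Set Filter
open scoped ENNReal NNReal InnerProductSpace

/-! ## §3 (O1) at propagator level — constants are fixed by a v2 distorted propagator -/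

/-- **Mean conservation for v2 distorted propagators over a frame modulation.**  For `0 ≤ s < Tw`, a `G(s)`-solenoidal `L²` datum `x` and a constant field
`c`: for a.e. `τ ∈ (0, Tw − s)`, `⟪U s (s+τ) x, c⟫ = ⟪x, c⟫` (existence of the distorted weak solution from `x` by `exists_sol`, identification with the
propagator by `repr`, mean conservation of the weak solution by `ae_integral_inner_const_eq_of_window`). -/
theorem IsDistortedPropagatorS.ae_inner_apply_const_eq {Tw θ nC : ℝ} {𝔸 : Torus.Visc4 (Fin 3)} {b : ℝ → VF}
    {G : ℝ → UnitAddTorus (Fin 3) → Matrix (Fin 3) (Fin 3) ℝ} {U : ℝ → ℝ → (V2 →L[ℝ] V2)}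
    (hU : IsDistortedPropagatorS Tw 𝔸 b G U) (hG : IsFrameModulation θ Tw nC G) (hTw : 0 < Tw)
    {s : ℝ} (hs0 : 0 ≤ s) (hsT : s < Tw) (x : V2) (hx : Torus.IsWeaklyDivFree (Torus.distort (G s) ((x : V2) : VF)))
    (c : EuclideanSpace ℝ (Fin 3)) :
    ∀ᵐ τ ∂(volume.restrict (Ioo 0 (Tw - s))), ⟪U s (s + τ) x, (memLp_top_const c).mono_exponent le_top |>.toLp _⟫_ℝ = ∫ y, ⟪((x : V2) : VF) y, c⟫_ℝ := by
  have hxm : MemLp ((x : V2) : VF) 2 volume := Lp.memLp x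
  obtain ⟨w, hw⟩ := hU.exists_sol s hs0 hsT _ hxm hx
  have hrepr := hU.repr s hs0 hsT _ hxm hx w hw
  -- mean conservation for the weak solution (clamped datum: all-time Piola through the window values)
  have hmean := ae_integral_inner_const_eq_of_window (d := Fin 3) (Tw := Tw) (Gm := G) (G := fun τ => G (s + τ))
    (fun t ht i j => hG.smooth t ht i j) (fun t ht i => hG.piola t ht i) (ρ := fun τ => max 0 (min (s + τ) Tw))
    (fun τ => ⟨le_max_left _ _, max_le hTw.le (min_le_right _ _)⟩) (fun τ => by funext y; exact hG.clamped (s + τ) y) hw c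
  filter_upwards [hrepr, hmean] with τ hτ hτm
  obtain ⟨hτ2, hτeq⟩ := hτ
  have hxe : hxm.toLp ((x : V2) : VF) = x := Lp.toLp_coeFn x hxm
  rw [hxe] at hτeq
  rw [← hτeq, ← hτm, MeasureTheory.L2.inner_def]
  refine integral_congr_ae ?_
  filter_upwards [hτ2.coeFn_toLp, ((memLp_top_const c).mono_exponent le_top).coeFn_toLp] with y hy hc
  rw [hy, hc]

end Summit.AnomalousDissipation.AnomalousDissipation.Theorems.SolenoidalFractalHomogenisation.LagrangianStep.CellClauseMod

end
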